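import Mathlib
import HarnessLib
import Literature.Probability.MarkovChains.PathComparison

/-!
# A local Poincaré inequality from paths: `‖f − f_r‖₂² ≤ η(r)𝓔(f,f)` (Diaconis–Saloff-Coste 1996, Lemma 5.1; Saloff-Coste 1997, Lemma 3.4.2)

HONEST FRAMING: exact (Metropolis-corrected) sampling algorithms for lattice gauge theory; figures
of merit are autocorrelation/cost numbers at stated couplings and volumes; no continuum-physics claim.

Sources (READ on the hub's materialised texts): P. Diaconis, L. Saloff-Coste, *Nash inequalities
for finite Markov chains*, J. Theoret. Probab. **9** (1996) 459–510 [DiaconisSaloffcoste1996Nash],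
§5.2 LEMMA 5.1, eq. (5.7), with its proof (p. 490: "`[f(x) − f_r(x)]² ≤ V(x,r)⁻¹ Σ_{y∈B(x,r)}
|f(x) − f(y)|²π(y) ≤ V(x,r)⁻¹ Σ_{y∈B(x,r)} |γ_{xy}| Σ_{e∈γ_{xy}} |f(e₊) − f(e₋)|² π(y)`", then
multiply by `π(x)`, sum in `x` and exchange the sums); L. Saloff-Coste, *Lectures on finite Markov
chains*, LNM 1665 (1997) [Saloffcoste1997], §3.4 LEMMA 3.4.2 ("See [28], Lemma 5.1").  Everything
below is PROVED (finite sums; 0 named facts).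

THE STATEMENT.  Fix paths `γ_{xy}` from `x` to `y` using edges `e` with `Q(e) = π(e₋)K(e₋,e₊) > 0`,
and averaging sets `B(x,r)` of volume `V(x,r) = π(B(x,r))` (balls of an adapted edge set in the
sources; any family of sets — the proof never uses the metric, cf. REMARK 5.4 (2) of the first
source); `f_r(x) = V(x,r)⁻¹Σ_{y∈B(x,r)} f(y)π(y)`.  Then **`‖f − f_r‖₂² ≤ η(r)𝓔(f,f)`** with
**`η(r) = max_e (2/Q(e)) Σ_{x, y ∈ B(x,r) : γ_{xy} ∋ e} |γ_{xy}| π(x)π(y)/V(x,r)`** — typed, as in the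
tree's comparison THEOREM 13.20 (`PathComparison.lean`), for any `η` with `2·Σ_{…} ≤ η·Q(e)` for
every edge `e` (pairs `(x,y)` counted with the multiplicity of `e` in `γ_{xy}`, which is the printed
indicator for paths without repeated edges).  PROOF = the printed one, organised through THEOREM
13.20 with the auxiliary kernel `K̃(x,y) = π(y)1_{B(x,r)}(y)/V(x,r)` ("our" `𝓔̃(f) = ½Σ_x π(x)V(x,r)⁻¹
Σ_{y∈B(x,r)}(f(x) − f(y))²π(y) ≥ ½‖f − f_r‖₂²` by Jensen, and `𝓔̃ ≤ (η/2)𝓔` by the path argument).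
Conventions: `dirichletForm π P f = 𝓔(f,f) = ½Σ_{x,y}π(x)P(x,y)(f(x) − f(y))²`, `piInner`, `EPath`,
`EPath.IsIn`, `edgeCongestion` (`PeskunOrdering.lean`, `PathComparison.lean`).  This is the
hypothesis "local Poincaré inequality `‖f − f_r‖₂² ≤ a r²𝓔(f,f)`" of DSC THEOREM 5.2 / SC THEOREM
3.4.3 (`ModerateGrowthNashInequality.lean`, whose `setAverage π B r f` is the `f_r` below) whenever
`η(r) ≤ a r²`.

## Content
* `ballKernel π B r` (the auxiliary kernel `K̃`), `ballKernel_nonneg`, `sum_ballKernel`;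
* `piInner_sub_setAvg_le_two_dirichletForm_ballKernel` — Jensen: `‖f − f_r‖₂² ≤ 2𝓔̃(f)`;
* **LEMMA 5.1 / LEMMA 3.4.2** `DiaconisSaloffcoste1996_lemma_5_1`: **`‖f − f_r‖₂² ≤ η𝓔(f,f)`**.

NOT HERE (scope, value-free): the evaluation of `η(r)` for examples (DSC §5.2–§5.4), moderate growth.
-/

namespace Literature.Probability.MarkovChains

open Finset Matrix

variable {X : Type*} [Fintype X] [DecidableEq X] {π : X → ℝ} {P : Matrix X X ℝ}

/-- The auxiliary averaging kernel `K̃(x,y) = π(y)1_{B(x,r)}(y)/V(x,r)`, `V(x,r) = π(B(x,r))`, so that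
`K̃f = f_r`. [cite: DiaconisSaloffcoste1996Nash, §5.2 eq. (5.4) and proof of Lemma 5.1] -/
noncomputable def ballKernel (π : X → ℝ) (B : X → ℕ → Finset X) (r : ℕ) : Matrix X X ℝ :=
  Matrix.of fun x y => if y ∈ B x r then π y / ∑ z ∈ B x r, π z else 0

omit [Fintype X] in
/-- `K̃ ≥ 0` for `π ≥ 0`. [cite: DiaconisSaloffcoste1996Nash, §5.2 eq. (5.4)] -/
theorem ballKernel_nonneg (hπ0 : ∀ x, 0 ≤ π x) (B : X → ℕ → Finset X) (r : ℕ) (x y : X) :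
    0 ≤ ballKernel π B r x y := by
  simp only [ballKernel, Matrix.of_apply]
  split_ifs
  · exact div_nonneg (hπ0 y) (sum_nonneg fun z _ => hπ0 z)
  · exact le_rfl

/-- `Σ_y K̃(x,y) = 1` when `V(x,r) > 0`. [cite: DiaconisSaloffcoste1996Nash, §5.2 eq. (5.4)] -/
theorem sum_ballKernel {B : X → ℕ → Finset X} {r : ℕ} {x : X} (hV : 0 < ∑ z ∈ B x r, π z) :
    ∑ y, ballKernel π B r x y = 1 := by
  simp only [ballKernel, Matrix.of_apply]
  rw [← sum_filter, show univ.filter (fun y => y ∈ B x r) = B x r by ext; simp, ← sum_div,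
    div_self hV.ne']

/-- **Jensen's step: `‖f − f_r‖₂² ≤ 2𝓔̃(f)`**, `𝓔̃` the Dirichlet form of `(K̃, π)`:
`[f(x) − f_r(x)]² ≤ V(x,r)⁻¹Σ_{y∈B(x,r)}|f(x) − f(y)|²π(y)` (all `V(x,r) > 0`, `π ≥ 0`), with
`f_r(x) = V(x,r)⁻¹Σ_{y∈B(x,r)}f(y)π(y)`. [cite: DiaconisSaloffcoste1996Nash, §5.2 proof of Lemma 5.1
(first inequality)] -/
theorem piInner_sub_setAvg_le_two_dirichletForm_ballKernel (hπ0 : ∀ x, 0 ≤ π x)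
    {B : X → ℕ → Finset X} {r : ℕ} (hV : ∀ x, 0 < ∑ z ∈ B x r, π z) (f : X → ℝ) :
    piInner π (fun x => f x - (∑ y ∈ B x r, π y * f y) / ∑ z ∈ B x r, π z)
        (fun x => f x - (∑ y ∈ B x r, π y * f y) / ∑ z ∈ B x r, π z) ≤
      2 * dirichletForm π (ballKernel π B r) f := by
  unfold piInner dirichletForm
  rw [← mul_assoc, show (2:ℝ) * (1 / 2) = 1 by norm_num, one_mul]
  refine sum_le_sum fun x _ => ?_
  -- pointwise Jensen at `x`: `(f(x) − f_r(x))² ≤ Σ_y K̃(x,y)(f(x) − f(y))²`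
  have hVx := hV x
  set V := ∑ z ∈ B x r, π z with hVdef
  -- `f(x) − f_r(x) = Σ_y K̃(x,y)(f(x) − f(y))`
  have hrepr : f x - (∑ y ∈ B x r, π y * f y) / V = ∑ y, ballKernel π B r x y * (f x - f y) := by
    have h1 : ∑ y, ballKernel π B r x y * (f x - f y) =
        f x * ∑ y, ballKernel π B r x y - ∑ y, ballKernel π B r x y * f y := by
      rw [mul_sum, ← sum_sub_distrib]; exact sum_congr rfl fun y _ => by ring
    rw [h1, sum_ballKernel hVx, mul_one]
    congr 1
    simp only [ballKernel, Matrix.of_apply, ite_mul, zero_mul]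
    rw [← sum_filter, show univ.filter (fun y => y ∈ B x r) = B x r by ext; simp, sum_div]
    exact sum_congr rfl fun y _ => by rw [hVdef]; ring
  -- Cauchy–Schwarz with the probability weights `K̃(x,·)`
  have hCS : (∑ y, ballKernel π B r x y * (f x - f y)) ^ 2 ≤
      (∑ y, ballKernel π B r x y) * ∑ y, ballKernel π B r x y * (f x - f y) ^ 2 := by
    have h := sum_mul_sq_le_sq_mul_sq univ (fun y => Real.sqrt (ballKernel π B r x y))
      (fun y => Real.sqrt (ballKernel π B r x y) * (f x - f y))
    have e1 : ∀ y, Real.sqrt (ballKernel π B r x y) * (Real.sqrt (ballKernel π B r x y) * (f x - f y)) =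
        ballKernel π B r x y * (f x - f y) := fun y => by
      rw [← mul_assoc, Real.mul_self_sqrt (ballKernel_nonneg hπ0 B r x y)]
    have e2 : ∀ y, Real.sqrt (ballKernel π B r x y) ^ 2 = ballKernel π B r x y := fun y =>
      Real.sq_sqrt (ballKernel_nonneg hπ0 B r x y)
    have e3 : ∀ y, (Real.sqrt (ballKernel π B r x y) * (f x - f y)) ^ 2 =
        ballKernel π B r x y * (f x - f y) ^ 2 := fun y => by rw [mul_pow, e2 y]
    simp only [e1, e2, e3] at h
    exact h
  rw [sum_ballKernel hVx, one_mul] at hCS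
  calc π x * ((f x - (∑ y ∈ B x r, π y * f y) / V) * (f x - (∑ y ∈ B x r, π y * f y) / V))
      = π x * (∑ y, ballKernel π B r x y * (f x - f y)) ^ 2 := by rw [hrepr, sq]
    _ ≤ π x * ∑ y, ballKernel π B r x y * (f x - f y) ^ 2 := mul_le_mul_of_nonneg_left hCS (hπ0 x)
    _ = ∑ y, π x * ballKernel π B r x y * (f x - f y) ^ 2 := by
        rw [mul_sum]; exact sum_congr rfl fun y _ => by ring

/-- **LEMMA 5.1 (Diaconis–Saloff-Coste 1996) = LEMMA 3.4.2 (Saloff-Coste 1997): the local Poincaré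
inequality from paths.**  Let `π ≥ 0` with `V(x,r) = π(B(x,r)) > 0` for all `x`, `K ≥ 0`, and for
each `x` and `y` let `γ_{xy}` be a path from `x` to `y` whose edges `e` have `K(e) > 0` whenever
`y ∈ B(x,r)` (and `π(y) > 0`).  If `η` satisfies, for every edge `e = (z,w)` with `K(z,w) > 0`,
**`2·Σ_{x, y ∈ B(x,r) : γ_{xy} ∋ e} |γ_{xy}| π(x)π(y)/V(x,r) ≤ η·Q(e)`**, `Q(e) = π(z)K(z,w)` (i.e.
`η ≥ η(r)` of eq. (5.7)), then **`‖f − f_r‖₂² ≤ η·𝓔(f,f)`** for every `f`.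
[cite: DiaconisSaloffcoste1996Nash, §5.2 Lemma 5.1 eq. (5.7); Saloffcoste1997, §3.4 Lemma 3.4.2] -/
theorem DiaconisSaloffcoste1996_lemma_5_1 (hπ0 : ∀ x, 0 ≤ π x) (hP0 : ∀ x y, 0 ≤ P x y)
    {B : X → ℕ → Finset X} {r : ℕ} (hV : ∀ x, 0 < ∑ z ∈ B x r, π z) (Γ : ∀ x y : X, EPath x y)
    (hE : ∀ x y, 0 < ballKernel π B r x y → (Γ x y).IsIn P) {η : ℝ}
    (hη : ∀ z w, 0 < P z w → 2 * edgeCongestion π (ballKernel π B r) Γ z w ≤ η * (π z * P z w))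
    (f : X → ℝ) :
    piInner π (fun x => f x - (∑ y ∈ B x r, π y * f y) / ∑ z ∈ B x r, π z)
        (fun x => f x - (∑ y ∈ B x r, π y * f y) / ∑ z ∈ B x r, π z) ≤
      η * dirichletForm π P f := by
  have h1 := piInner_sub_setAvg_le_two_dirichletForm_ballKernel hπ0 hV f
  have h2 := LevinPeres2017_thm_13_20 (π := π) hP0 hπ0 (ballKernel_nonneg hπ0 B r) Γ hE (B := η / 2)
    (fun z w hzw => by have := hη z w hzw; linarith) f
  linarith

omit [Fintype X] in
/-- The hypothesis `γ_{xy}` "is a `K`-path whenever `K̃(x,y) > 0`" unfolded: it suffices that `γ_{xy}`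
be a `K`-path for every `y ∈ B(x,r)`. [cite: DiaconisSaloffcoste1996Nash, §5.2 (paths `γ_{xy}` in the
graph `(X, A)` compatible with `Q`)] -/
theorem ballKernel_pos_imp {B : X → ℕ → Finset X} {r : ℕ} {Γ : ∀ x y : X, EPath x y}
    (hΓ : ∀ x y, y ∈ B x r → (Γ x y).IsIn P) (x y : X) (h : 0 < ballKernel π B r x y) :
    (Γ x y).IsIn P := by
  refine hΓ x y ?_
  by_contra hy
  simp [ballKernel, Matrix.of_apply, hy] at h

/-- The congestion of the auxiliary kernel unfolded: `Σ_{x,y} π(x)K̃(x,y)|γ_{xy}|·#_{e}(γ_{xy}) =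
Σ_x Σ_{y∈B(x,r)} π(x)π(y)|γ_{xy}|·#_{e}(γ_{xy})/V(x,r)` — the bracket of eq. (5.7).
[cite: DiaconisSaloffcoste1996Nash, §5.2 Lemma 5.1 eq. (5.7)] -/
theorem edgeCongestion_ballKernel (B : X → ℕ → Finset X) (r : ℕ) (Γ : ∀ x y : X, EPath x y)
    (z w : X) :
    edgeCongestion π (ballKernel π B r) Γ z w =
      ∑ x, ∑ y ∈ B x r, π x * π y / (∑ u ∈ B x r, π u) * (Γ x y).len * (Γ x y).edgeCount z w := by
  unfold edgeCongestion
  refine sum_congr rfl fun x _ => ?_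
  rw [← sum_filter_add_sum_filter_not univ (fun y => y ∈ B x r)]
  have h0 : ∑ y ∈ univ.filter (fun y => ¬ y ∈ B x r),
      π x * ballKernel π B r x y * (Γ x y).len * (Γ x y).edgeCount z w = 0 :=
    sum_eq_zero fun y hy => by
      simp only [ballKernel, Matrix.of_apply, if_neg (mem_filter.1 hy).2]; ring
  rw [h0, add_zero, show univ.filter (fun y => y ∈ B x r) = B x r by ext; simp]
  refine sum_congr rfl fun y hy => ?_
  simp only [ballKernel, Matrix.of_apply, if_pos hy]
  ring

end Literature.Probability.MarkovChains
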